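import Mathlib
import HarnessLib
import Summits.NavierStokesRegularity.NavierStokesRegularity.Theorems.PoloidalWindowDoorLrcModEntireTwistingTHFlatLeverPointwise
import Summits.NavierStokesRegularity.NavierStokesRegularity.Theorems.PoloidalWindowDoorLrcModEntireRidgeAssembly
import Summits.NavierStokesRegularity.NavierStokesRegularity.Theorems.PoloidalWindowDoorLrcModEntireTwistingTHFlatChain

/-!
# Item `LrcModEntire` (stmt-NavierStokesRegularity-20428), registry twist_split v8 — THE FLAT LEVER, SEPARATION THEOREM: on a flat hot arc, points where the transversal quartic form has a null direction cannot separate definite points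
LEAD of item 20428 ns-poloidal-K2-p3 g15 (`--supports stmt-NavierStokesRegularity-20428 --as helper`).  Memo `Cruxes/LrcModEntire/T2B-g15.md` §17c.  Pointwise version of `…FlatAssembly` /
`…FlatChain`: the tube may be THICK (no `64Cr ≤ λ`) provided the centre is the only hot point of each cross-section, and points of the arc are either DEFINITE (`λ_s(n⁴+z⁴) ≤ Q_s`,
`m(s) = min_η Q_s(η,1)`) or carry a NULL DIRECTION inside the tube (`Q_s(η₀,1) = 0`, `m(s) = 0`).  Then `m` is quasiconcave along the arc (`…FlatLeverPointwise`), so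
**if the two ends of the arc are definite, every point of the arc has `m > 0`: no null direction in between** — e.g. no second hot curve can pierce the thread plane through an
interior point of a definite flat branch.
* `tendsto_coeff_of_definite'` — the definite-point limit with joint continuity only at the points of the closed tube (what a tube chart supplies);
* `quasiconcaveOn_quarticCoeff_pointwise` — profile level (Peakless VERBATIM + tube chart + per-point dichotomy ⇒ `m` quasiconcave);
* `pos_of_definite_ends` — the separation corollary at profile level;
* `quasiconcaveOn_quarticCoeff_of_flatData_pointwise` / `pos_of_definite_ends_of_flatData` — the same FROM THE BINDER of `stub_T2bFlat` (flat jets by `…FlatRidgeJet`/`…FlatRidgeCubic`,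
  expansion by `…FlatTaylor`, global bound from the hot-spot normalisation).
WHAT THIS IS NOT: not a claim about Navier–Stokes regularity and not a proof of `stub_T2bFlat` — structure of its hypothetical flat web (bears_on LADDER-NS N0, item 20428 / crux 19708;
OPEN, ⟨27893⟩ OPEN).
-/

noncomputable section

set_option linter.style.longLine false
-- the summit and its single sub-problem share the name (CONVENTIONS §1), as in every Theorems file
set_option linter.dupNamespace false

namespace Summit.NavierStokesRegularity.NavierStokesRegularity.Theorems.PoloidalWindowDoorLrcModEntireTwistingTHFlatSeparation

open Set Function Filter Topology Metric
open scoped RealInnerProductSpace InnerProductSpace ContDiff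
open Literature.Analysis Literature.Analysis.FluidPDE Literature.Analysis.UnboundedOperators
open Summit.NavierStokesRegularity.NavierStokesRegularity.Theorems
open Summit.NavierStokesRegularity.NavierStokesRegularity.Theorems.LocalSineTubeDoorProfileAlignedWindowRigidityAncient
open Summit.NavierStokesRegularity.NavierStokesRegularity.Theorems.PoloidalWindowDoorLrcModEntireRidgeSecondOrder
open Summit.NavierStokesRegularity.NavierStokesRegularity.Theorems.PoloidalWindowDoorLrcModEntireTwistingTHFlatLever
open Summit.NavierStokesRegularity.NavierStokesRegularity.Theorems.PoloidalWindowDoorLrcModEntireTwistingTHFlatLeverPointwise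
open Summit.NavierStokesRegularity.NavierStokesRegularity.Theorems.PoloidalWindowDoorLrcModEntireRidgeQuasiconvex
open Summit.NavierStokesRegularity.NavierStokesRegularity.Theorems.PoloidalWindowDoorLrcModEntireLateralLevel
open Summit.NavierStokesRegularity.NavierStokesRegularity.Theorems.PoloidalWindowDoorLrcModEntireRidgeAssembly
open Summit.NavierStokesRegularity.NavierStokesRegularity.Theorems.PoloidalWindowDoorLrcModEntireTwistingTHFlatRidgeJet
open Summit.NavierStokesRegularity.NavierStokesRegularity.Theorems.PoloidalWindowDoorLrcModEntireTwistingTHFlatRidgeCubic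
open Summit.NavierStokesRegularity.NavierStokesRegularity.Theorems.PoloidalWindowDoorLrcModEntireTwistingTHFlatTaylor

/-- **The limit at a DEFINITE point (joint continuity only AT the points of the closed tube `|n| ≤ r`, the form a tube chart supplies).**  Class-free: `g(n,z)` jointly continuous,
`|g − (N − Q)| ≤ C(|n|+|z|)⁵` on `|n| ≤ r`, `|z| ≤ 1`, `Q` degree-4-homogeneous and definite (`λ(n⁴+z⁴) ≤ Q`), `m = min_η Q(η,1)` attained at `|η₀| ≤ K`, and `g(n,0) < N` for
`0 < |n| ≤ r` (the tube may be THICK: no `64Cr ≤ λ`).  Then `(max_{|n|≤r} g(·,z) − N)/z⁴ → −m` as `z → 0⁺`. -/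
theorem tendsto_coeff_of_definite' {g Q : ℝ → ℝ → ℝ} {N lam m η₀ K C r : ℝ}
    (hhom : ∀ η t : ℝ, Q (η * t) t = t ^ 4 * Q η 1)
    (hlam : 0 < lam) (hdef : ∀ n z, lam * (n ^ 4 + z ^ 4) ≤ Q n z)
    (hm : ∀ η, m ≤ Q η 1) (hη₀ : Q η₀ 1 = m) (hK : |η₀| ≤ K) (hC : 0 ≤ C) (hr : 0 < r)
    (hH : ∀ n z : ℝ, |n| ≤ r → |z| ≤ 1 → |g n z - (N - Q n z)| ≤ C * (|n| + |z|) ^ 5)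
    (hcont : ∀ n : ℝ, |n| ≤ r → ∀ z : ℝ, ContinuousAt (Function.uncurry g) (n, z)) (hsole : ∀ n : ℝ, |n| ≤ r → n ≠ 0 → g n 0 < N) :
    Tendsto (fun z => (sSup ((fun n => g n z) '' Icc (-r) r) - N) / z ^ 4) (𝓝[>] 0) (𝓝 (-m)) := by
  have hK0 : 0 ≤ K := (abs_nonneg _).trans hK
  -- a thin radius
  set r' : ℝ := min r (lam / (64 * C + 1)) with hr'
  have hr'0 : 0 < r' := lt_min hr (by positivity)
  have hr'r : r' ≤ r := min_le_left _ _
  have hthin : 64 * C * r' ≤ lam := by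
    have h1 : 64 * C * r' ≤ 64 * C * (lam / (64 * C + 1)) := mul_le_mul_of_nonneg_left (min_le_right _ _) (by positivity)
    have h2 : 64 * C * (lam / (64 * C + 1)) ≤ lam := by
      rw [mul_div_assoc', div_le_iff₀ (by positivity)]; nlinarith
    exact h1.trans h2
  -- cross-sections are continuous; images of compact intervals are compact
  have hsec : ∀ z : ℝ, ContinuousOn (fun n => g n z) (Icc (-r) r) := by
    intro z n hn
    have h1 : ContinuousAt (Function.uncurry g) (n, z) := hcont n (abs_le.2 ⟨hn.1, hn.2⟩) z
    have h2 : ContinuousAt (fun n' : ℝ => (n', z)) n := (continuous_id.prodMk continuous_const).continuousAt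
    have h3 : ContinuousAt (fun n' : ℝ => g n' z) n := by
      have := ContinuousAt.comp_of_eq (f := fun n' : ℝ => (n', z)) h1 h2 rfl
      simpa [Function.comp_def, Function.uncurry] using this
    exact h3.continuousWithinAt
  have hcpt : ∀ (z a b : ℝ), Icc a b ⊆ Icc (-r) r → IsCompact ((fun n => g n z) '' Icc a b) := fun z a b hab =>
    isCompact_Icc.image_of_continuousOn ((hsec z).mono hab)
  have hsubI : Icc (-r') r' ⊆ Icc (-r) r := Icc_subset_Icc (by linarith [min_le_left r (lam / (64 * C + 1))]) (min_le_left _ _)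
  set B : ℝ := max 1 (2 * (|m| + 32 * C + C * (K + 1) ^ 5) / lam) with hB
  set C'' : ℝ := C * (K + 1) ^ 5 + C * (B + 1) ^ 5 with hC''
  -- the thin-tube expansion at radius `r'`
  have hthinexp : ∀ z : ℝ, 0 < z → z ≤ min 1 (r' / (K + 1)) →
      |sSup ((fun n => g n z) '' Icc (-r') r') - (N - m * z ^ 4)| ≤ C'' * z ^ 5 := by
    intro z hz hzle
    have hz1 : |z| ≤ 1 := by rw [abs_of_pos hz]; exact hzle.trans (min_le_left _ _)
    have hKz : K * |z| ≤ r' := by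
      rw [abs_of_pos hz]
      have h1 : K * z ≤ K * (r' / (K + 1)) := mul_le_mul_of_nonneg_left (hzle.trans (min_le_right _ _)) hK0
      have h2 : K * (r' / (K + 1)) ≤ r' := by rw [mul_div_assoc', div_le_iff₀ (by linarith)]; nlinarith [hr'0.le]
      exact h1.trans h2
    have h := abs_sSup_sub_le_of_quarticRidgeExpansion' (g := g) (δ := 1) hhom hlam hdef hm hη₀ hK hC hr'0 hthin
      (fun n z' hn hz' => hH n z' (hn.trans hr'r) hz') (fun z' _ => (hsec z').mono hsubI) hz1 hz1 hKz
    rw [abs_of_pos hz] at h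
    exact h
  -- the annulus `r' ≤ |n| ≤ r` is cold at height 0, by a margin `d`
  set A : Set ℝ := Icc (-r) (-r') ∪ Icc r' r with hA
  have hAc : IsCompact A := isCompact_Icc.union isCompact_Icc
  have hAne : A.Nonempty := ⟨r, Or.inr ⟨hr'r, le_rfl⟩⟩
  have hAmem : ∀ n ∈ A, |n| ≤ r ∧ n ≠ 0 ∧ r' ≤ |n| := by
    intro n hn
    rcases hn with ⟨h1, h2⟩ | ⟨h1, h2⟩
    · refine ⟨abs_le.2 ⟨h1, by linarith⟩, by intro h0; rw [h0] at h2; linarith, ?_⟩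
      rw [abs_of_neg (by linarith)]; linarith
    · refine ⟨abs_le.2 ⟨by linarith, h2⟩, by intro h0; rw [h0] at h1; linarith, ?_⟩
      rw [abs_of_pos (by linarith)]; exact h1
  have hAsub : A ⊆ Icc (-r) r := fun n hn => ⟨(abs_le.1 (hAmem n hn).1).1, (abs_le.1 (hAmem n hn).1).2⟩
  obtain ⟨n₀, hn₀A, hn₀max⟩ := hAc.exists_isMaxOn hAne ((hsec 0).mono hAsub)
  set d : ℝ := N - g n₀ 0 with hd
  have hd0 : 0 < d := by
    have := hsole n₀ (hAmem n₀ hn₀A).1 (hAmem n₀ hn₀A).2.1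
    rw [hd]; linarith
  have hcold0 : ∀ n ∈ A, g n 0 ≤ N - d := fun n hn => by
    have := hn₀max hn; rw [hd]; simp only [mem_setOf_eq] at this; linarith
  -- … and stays cold for small `z` (compactness of the annulus, joint continuity)
  have hcold : ∀ᶠ z in 𝓝 (0 : ℝ), ∀ n ∈ A, g n z < N - d / 2 := by
    refine hAc.eventually_forall_of_forall_eventually (P := fun z n => g n z < N - d / 2) fun n hn => ?_
    have hc : ContinuousAt (fun p : ℝ × ℝ => g p.2 p.1) ((0 : ℝ), n) := by
      have h1 : ContinuousAt (Function.uncurry g) (Prod.swap ((0 : ℝ), n)) := hcont n (hAmem n hn).1 0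
      exact h1.comp continuous_swap.continuousAt
    have hlt : g n 0 < N - d / 2 := by linarith [hcold0 n hn]
    exact hc.eventually (gt_mem_nhds hlt)
  -- the polynomial margin is eventually below `d/2`
  have hpoly : ∀ᶠ z in 𝓝 (0 : ℝ), |m| * z ^ 4 + C'' * |z| ^ 5 < d / 2 := by
    have hc : Continuous fun z : ℝ => |m| * z ^ 4 + C'' * |z| ^ 5 := by fun_prop
    have h0 : (fun z : ℝ => |m| * z ^ 4 + C'' * |z| ^ 5) 0 < d / 2 := by simp; linarith
    exact hc.continuousAt.eventually (gt_mem_nhds h0)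
  -- assemble the eventual two-sided bound at radius `r`
  refine tendsto_coeff_of_eventually (C := C'') ?_
  have hsmall : ∀ᶠ z in 𝓝[>] (0 : ℝ), z ≤ min 1 (r' / (K + 1)) := by
    have : ∀ᶠ z in 𝓝 (0 : ℝ), z ≤ min 1 (r' / (K + 1)) := by
      have hpos : 0 < min 1 (r' / (K + 1)) := lt_min one_pos (by positivity)
      filter_upwards [Metric.closedBall_mem_nhds (0 : ℝ) hpos] with z hz
      rw [Metric.mem_closedBall, Real.dist_eq, sub_zero] at hz
      exact (le_abs_self z).trans hz
    exact nhdsWithin_le_nhds this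
  have hposz : ∀ᶠ z in 𝓝[>] (0 : ℝ), 0 < z := self_mem_nhdsWithin
  filter_upwards [hposz, hsmall, nhdsWithin_le_nhds hcold, nhdsWithin_le_nhds hpoly] with z hz hzle hcoldz hpolyz
  have hthin_z := hthinexp z hz hzle
  have hC''0 : 0 ≤ C'' := by positivity
  -- images at radius r' and r
  have hbig_bdd : BddAbove ((fun n => g n z) '' Icc (-r) r) := (hcpt z (-r) r Subset.rfl).bddAbove
  have hsub : (fun n => g n z) '' Icc (-r') r' ⊆ (fun n => g n z) '' Icc (-r) r :=
    image_mono (Icc_subset_Icc (by linarith) hr'r)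
  have hsmall_ne : ((fun n => g n z) '' Icc (-r') r').Nonempty := ⟨g 0 z, 0, ⟨by linarith, hr'0.le⟩, rfl⟩
  have hmono : sSup ((fun n => g n z) '' Icc (-r') r') ≤ sSup ((fun n => g n z) '' Icc (-r) r) := csSup_le_csSup hbig_bdd hsmall_ne hsub
  obtain ⟨nstar, hnstar, hmax⟩ := (hcpt z (-r) r Subset.rfl).sSup_mem ⟨g 0 z, 0, ⟨by linarith, hr.le⟩, rfl⟩
  have hlow := (abs_le.1 hthin_z).1
  have hup_thin := (abs_le.1 hthin_z).2
  rw [abs_le]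
  constructor
  · linarith
  · -- the maximiser over `|n| ≤ r` lies in the thin tube
    by_cases hin : |nstar| ≤ r'
    · have hle : g nstar z ≤ sSup ((fun n => g n z) '' Icc (-r') r') :=
        le_csSup (hcpt z (-r') r' hsubI).bddAbove ⟨nstar, ⟨(abs_le.1 hin).1, (abs_le.1 hin).2⟩, rfl⟩
      rw [← hmax]; linarith
    · exfalso
      have hA' : nstar ∈ A := by
        push Not at hin
        rcases le_or_gt 0 nstar with h0 | h0
        · right; exact ⟨by rw [abs_of_nonneg h0] at hin; exact hin.le, hnstar.2⟩
        · left; exact ⟨hnstar.1, by rw [abs_of_neg h0] at hin; linarith⟩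
      have h1 := hcoldz nstar hA'
      have hz5 : C'' * z ^ 5 ≤ C'' * |z| ^ 5 := by rw [abs_of_pos hz]
      have hm4 : m * z ^ 4 ≤ |m| * z ^ 4 := mul_le_mul_of_nonneg_right (le_abs_self m) (pow_nonneg hz.le 4)
      have : N - d / 2 < sSup ((fun n => g n z) '' Icc (-r') r') := by linarith
      linarith [hmax.symm.le, hmono]


variable {v : ℝ → EuclideanSpace ℝ (Fin 3) → EuclideanSpace ℝ (Fin 3)}

/-- Joint continuity of the tube integrand `(n, z) ↦ σ·v₂(−1, P z (e (s,n)))` at the points of the closed tube (inside the chart source). -/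
theorem continuousAt_tubeIntegrand (hcont : ContinuousOn (uncurry v) (Iio (0 : ℝ) ×ˢ univ)) (σ : ℝ)
    (e : OpenPartialHomeomorph (ℝ × ℝ) (ℝ × ℝ)) {a₁ a₂ r : ℝ} (hsrc : Icc a₁ a₂ ×ˢ Icc (-r) r ⊆ e.source)
    {P : ℝ → ℝ × ℝ → EuclideanSpace ℝ (Fin 3)} (hP : ∀ z₀ q, P z₀ q = WithLp.toLp 2 ![q.1, q.2, z₀])
    {s : ℝ} (hs : s ∈ Icc a₁ a₂) (n : ℝ) (hn : |n| ≤ r) (z : ℝ) :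
    ContinuousAt (Function.uncurry fun n z => σ * v (-1) (P z (e (s, n))) 2) (n, z) := by
  have hvc : Continuous fun y : EuclideanSpace ℝ (Fin 3) => v (-1) y 2 := continuous_slice_two hcont (by norm_num)
  have hPc : Continuous fun p : ℝ × (ℝ × ℝ) => P p.1 p.2 := by
    have : (fun p : ℝ × (ℝ × ℝ) => P p.1 p.2) = fun p => WithLp.toLp 2 ![p.2.1, p.2.2, p.1] := funext fun p => hP p.1 p.2
    rw [this]
    refine (PiLp.continuous_toLp 2 _).comp (continuous_pi fun i => ?_)
    fin_cases i <;> simp <;> fun_prop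
  have he : ContinuousAt e (s, n) := e.continuousAt (hsrc ⟨hs, ⟨(abs_le.1 hn).1, (abs_le.1 hn).2⟩⟩)
  have h1 : ContinuousAt (fun p : ℝ × ℝ => e (s, p.1)) (n, z) := by
    have h2 : ContinuousAt (fun p : ℝ × ℝ => ((s, p.1) : ℝ × ℝ)) (n, z) := (continuous_const.prodMk continuous_fst).continuousAt
    exact ContinuousAt.comp_of_eq he h2 rfl
  have h3 : ContinuousAt (fun p : ℝ × ℝ => P p.2 (e (s, p.1))) (n, z) :=
    hPc.continuousAt.comp (f := fun p : ℝ × ℝ => (p.2, e (s, p.1))) (continuous_snd.continuousAt.prodMk h1)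
  exact continuousAt_const.mul (hvc.continuousAt.comp h3)

/-- **THE QUARTIC DEFICIT IS QUASICONCAVE ALONG A FLAT HOT ARC — pointwise form (thick tube, per-point dichotomy definite / null direction).**  See the module docstring. -/
theorem quasiconcaveOn_quarticCoeff_pointwise
    (hpk : ∀ (s z₀ σ M : ℝ) (K O : Set (EuclideanSpace ℝ (Fin 3))), s < 0 →
      ((σ = 1 ∨ σ = -1) ∧ IsCompact K ∧ K.Nonempty ∧ (∀ y ∈ K, y 2 = z₀ ∧ σ * v s y 2 = M) ∧
        IsOpen O ∧ K ⊆ O ∧ (∀ y ∈ O, y 2 = z₀ → σ * v s y 2 ≤ M) ∧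
        (∀ y ∈ O, y 2 = z₀ → σ * v s y 2 = M → y ∈ K)) → False)
    (hcont : ContinuousOn (uncurry v) (Iio (0 : ℝ) ×ˢ univ)) {σ N : ℝ} (hσ : σ = 1 ∨ σ = -1)
    (e : OpenPartialHomeomorph (ℝ × ℝ) (ℝ × ℝ)) {a₁ a₂ r : ℝ} (ha : a₁ ≤ a₂) (hr : 0 < r) (hsrc : Icc a₁ a₂ ×ˢ Icc (-r) r ⊆ e.source)
    {P : ℝ → ℝ × ℝ → EuclideanSpace ℝ (Fin 3)} (hP : ∀ z₀ q, P z₀ q = WithLp.toLp 2 ![q.1, q.2, z₀])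
    (hlat0 : ∀ a ∈ Icc a₁ a₂, ∀ n : ℝ, (n = r ∨ n = -r) → σ * v (-1) (P 0 (e (a, n))) 2 < N)
    (hmid0 : ∀ a ∈ Icc a₁ a₂, σ * v (-1) (P 0 (e (a, 0))) 2 = N)
    (hsole : ∀ a ∈ Icc a₁ a₂, ∀ n : ℝ, |n| ≤ r → n ≠ 0 → σ * v (-1) (P 0 (e (a, n))) 2 < N)
    (hglob : ∀ x, σ * v (-1) x 2 ≤ N)
    {Q : ℝ → ℝ → ℝ → ℝ} {m : ℝ → ℝ} {C : ℝ} (hC : 0 ≤ C)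
    (hhom : ∀ s ∈ Icc a₁ a₂, ∀ η t : ℝ, Q s (η * t) t = t ^ 4 * Q s η 1)
    (hexp : ∀ s ∈ Icc a₁ a₂, ∀ n z : ℝ, |σ * v (-1) (P z (e (s, n))) 2 - (N - Q s n z)| ≤ C * (|n| + |z|) ^ 5)
    (hpt : ∀ s ∈ Icc a₁ a₂, (∃ lam η₀ K : ℝ, 0 < lam ∧ (∀ n z : ℝ, lam * (n ^ 4 + z ^ 4) ≤ Q s n z) ∧ (∀ η : ℝ, m s ≤ Q s η 1) ∧
        Q s η₀ 1 = m s ∧ |η₀| ≤ K) ∨ (m s = 0 ∧ ∃ η₀ : ℝ, Q s η₀ 1 = 0)) :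
    QuasiconcaveOn ℝ (Icc a₁ a₂) m := by
  -- (LL) and (Q1)
  obtain ⟨δ, hδ, mm, hLL⟩ := lateralLevel_persist hcont e ha hsrc hr.le hP hlat0 hmid0
  have hvc : Continuous fun y : EuclideanSpace ℝ (Fin 3) => v (-1) y 2 := continuous_slice_two hcont (by norm_num)
  set R : ℝ → ℝ → ℝ := fun s z => sSup ((fun n : ℝ => σ * v (-1) (P z (e (s, n))) 2) '' Icc (-r) r) with hR
  have hqc : ∀ z : ℝ, 0 < z → z ≤ δ / 2 → QuasiconvexOn ℝ (Icc a₁ a₂) fun s => R s z := by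
    intro z hz hzδ'
    have hzabs : |z| < δ := by rw [abs_of_pos hz]; linarith
    obtain ⟨hlat, hmid⟩ := hLL (-1) z (by norm_num [hδ]) hzabs
    exact crossSectionMax_quasiconvexOn_of_peakless hpk (by norm_num) hσ hvc (hP z) e hr.le hsrc hlat hmid
  -- pointwise limits
  have hlim : ∀ s ∈ Icc a₁ a₂, Tendsto (fun z => (R s z - N) / z ^ 4) (𝓝[>] 0) (𝓝 (-m s)) := by
    intro s hs
    have hH : ∀ n z : ℝ, |n| ≤ r → |z| ≤ 1 → |σ * v (-1) (P z (e (s, n))) 2 - (N - Q s n z)| ≤ C * (|n| + |z|) ^ 5 :=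
      fun n z _ _ => hexp s hs n z
    rcases hpt s hs with ⟨lam, η₀, K, hlam, hdef, hmin, hη₀, hK⟩ | ⟨hm0, η₀, hnull⟩
    · exact tendsto_coeff_of_definite' (g := fun n z => σ * v (-1) (P z (e (s, n))) 2) (hhom s hs) hlam hdef hmin hη₀ hK hC hr hH
        (fun n hn z => continuousAt_tubeIntegrand hcont σ e hsrc hP hs n hn z) (fun n hn hn0 => hsole s hs n hn hn0)
    · rw [hm0, neg_zero]
      exact tendsto_coeff_of_nullDirection (g := fun n z => σ * v (-1) (P z (e (s, n))) 2) (hhom s hs) hnull hC hr hH (fun n z _ => hglob _)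
  -- (F-ii, pointwise)
  have h := quasiconvexOn_of_tendsto_pow (convex_Icc a₁ a₂) (by linarith : 0 < δ / 2) 4 hlim hqc
  intro c
  have hc := h (-c)
  have e1 : {x | x ∈ Icc a₁ a₂ ∧ c ≤ m x} = {x | x ∈ Icc a₁ a₂ ∧ (fun s => -m s) x ≤ -c} := by
    ext x; simp only [mem_setOf_eq, neg_le_neg_iff]
  rw [e1]; exact hc

/-- **SEPARATION: definite ends ⇒ no null direction in between** (profile level). -/
theorem pos_of_definite_ends
    (hpk : ∀ (s z₀ σ M : ℝ) (K O : Set (EuclideanSpace ℝ (Fin 3))), s < 0 →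
      ((σ = 1 ∨ σ = -1) ∧ IsCompact K ∧ K.Nonempty ∧ (∀ y ∈ K, y 2 = z₀ ∧ σ * v s y 2 = M) ∧
        IsOpen O ∧ K ⊆ O ∧ (∀ y ∈ O, y 2 = z₀ → σ * v s y 2 ≤ M) ∧
        (∀ y ∈ O, y 2 = z₀ → σ * v s y 2 = M → y ∈ K)) → False)
    (hcont : ContinuousOn (uncurry v) (Iio (0 : ℝ) ×ˢ univ)) {σ N : ℝ} (hσ : σ = 1 ∨ σ = -1)
    (e : OpenPartialHomeomorph (ℝ × ℝ) (ℝ × ℝ)) {a₁ a₂ r : ℝ} (ha : a₁ ≤ a₂) (hr : 0 < r) (hsrc : Icc a₁ a₂ ×ˢ Icc (-r) r ⊆ e.source)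
    {P : ℝ → ℝ × ℝ → EuclideanSpace ℝ (Fin 3)} (hP : ∀ z₀ q, P z₀ q = WithLp.toLp 2 ![q.1, q.2, z₀])
    (hlat0 : ∀ a ∈ Icc a₁ a₂, ∀ n : ℝ, (n = r ∨ n = -r) → σ * v (-1) (P 0 (e (a, n))) 2 < N)
    (hmid0 : ∀ a ∈ Icc a₁ a₂, σ * v (-1) (P 0 (e (a, 0))) 2 = N)
    (hsole : ∀ a ∈ Icc a₁ a₂, ∀ n : ℝ, |n| ≤ r → n ≠ 0 → σ * v (-1) (P 0 (e (a, n))) 2 < N)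
    (hglob : ∀ x, σ * v (-1) x 2 ≤ N)
    {Q : ℝ → ℝ → ℝ → ℝ} {m : ℝ → ℝ} {C : ℝ} (hC : 0 ≤ C)
    (hhom : ∀ s ∈ Icc a₁ a₂, ∀ η t : ℝ, Q s (η * t) t = t ^ 4 * Q s η 1)
    (hexp : ∀ s ∈ Icc a₁ a₂, ∀ n z : ℝ, |σ * v (-1) (P z (e (s, n))) 2 - (N - Q s n z)| ≤ C * (|n| + |z|) ^ 5)
    (hpt : ∀ s ∈ Icc a₁ a₂, (∃ lam η₀ K : ℝ, 0 < lam ∧ (∀ n z : ℝ, lam * (n ^ 4 + z ^ 4) ≤ Q s n z) ∧ (∀ η : ℝ, m s ≤ Q s η 1) ∧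
        Q s η₀ 1 = m s ∧ |η₀| ≤ K) ∨ (m s = 0 ∧ ∃ η₀ : ℝ, Q s η₀ 1 = 0))
    (h₁ : 0 < m a₁) (h₂ : 0 < m a₂) {s : ℝ} (hs : s ∈ Icc a₁ a₂) : 0 < m s :=
  no_interior_degeneracy (quasiconcaveOn_quarticCoeff_pointwise hpk hcont hσ e ha hr hsrc hP hlat0 hmid0 hsole hglob hC hhom hexp hpt) h₁ h₂ hs


/-- **SEPARATION FROM THE BINDER of `stub_T2bFlat`.**  Class package, global bilinear (TH), Peakless, `hcrit`, hot-spot normalisation, «empty planar interior», the sign `σ` and the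
FLAT ridge law (all VERBATIM clauses of the registered stub), a flat hot arc in a tube chart whose centre is the only hot point of each cross-section, a fifth-derivative bound of
the signed slice, the quartic forms `Q_s = −D⁴(σv₂(−1,·))(γ s)[(nν(s)+ze₂)⁴]/24` with the per-point dichotomy (definite with minimum `m(s)`, or a null direction with `m(s) = 0`),
and DEFINITE ENDS `m(a₁), m(a₂) > 0` ⇒ **`m > 0` on the whole arc** (no null direction of the transversal quartic form strictly inside). -/
theorem pos_of_definite_ends_of_flatData {C : ℝ} (hdec : HasTypeITimeDecay C v) (hcont : ContinuousOn (uncurry v) (Iio (0 : ℝ) ×ˢ univ))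
    (hmild : ∀ s t : ℝ, s < t → t < 0 → ∀ x, v t x = heatExtension (v s) (t - s) x - oseenDuhamel 1 s v v t x)
    (hdiv : ∀ t < 0, VectorCalculus.IsDivFree (v t))
    (hTH : ∀ t < 0, ∀ x x' : EuclideanSpace ℝ (Fin 3), x 2 = x' 2 → ∀ b c : Fin 3, b ≠ 2 → c ≠ 2 →
      fderiv ℝ (v t) x (EuclideanSpace.single 2 1) b * fderiv ℝ (v t) x' (EuclideanSpace.single c 1) 2 =
        fderiv ℝ (v t) x' (EuclideanSpace.single 2 1) c * fderiv ℝ (v t) x (EuclideanSpace.single b 1) 2)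
    (hpk : ∀ (s z₀ σ M : ℝ) (K O : Set (EuclideanSpace ℝ (Fin 3))), s < 0 →
      ((σ = 1 ∨ σ = -1) ∧ IsCompact K ∧ K.Nonempty ∧ (∀ y ∈ K, y 2 = z₀ ∧ σ * v s y 2 = M) ∧
        IsOpen O ∧ K ⊆ O ∧ (∀ y ∈ O, y 2 = z₀ → σ * v s y 2 ≤ M) ∧
        (∀ y ∈ O, y 2 = z₀ → σ * v s y 2 = M → y ∈ K)) → False)
    (hcrit : ∀ y ∈ {y : EuclideanSpace ℝ (Fin 3) | y 2 = 0 ∧ v (-1) y 2 = v (-1) 0 2}, fderiv ℝ (fun x => v (-1) x 2) y = 0)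
    (hne : v (-1) 0 2 ≠ 0) (hhot : ∀ t < 0, ∀ x, Real.sqrt (-t) * |v t x 2| ≤ |v (-1) 0 2|)
    (hproper : ∀ y ∈ {y : EuclideanSpace ℝ (Fin 3) | y 2 = 0 ∧ v (-1) y 2 = v (-1) 0 2}, ∀ r : ℝ, 0 < r →
      ∃ y' : EuclideanSpace ℝ (Fin 3), y' 2 = 0 ∧ dist y' y < r ∧ v (-1) y' 2 ≠ v (-1) 0 2)
    {σ : ℝ} (hσ : σ = 1 ∨ σ = -1) (hσN : σ * v (-1) 0 2 = |v (-1) 0 2|)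
    (hflatlaw : ∀ y : EuclideanSpace ℝ (Fin 3), y 2 = 0 → v (-1) y 2 = v (-1) 0 2 →
      fderiv ℝ (fderiv ℝ (fun x => σ * v (-1) x 2)) y (EuclideanSpace.single 0 1) (EuclideanSpace.single 0 1) +
        fderiv ℝ (fderiv ℝ (fun x => σ * v (-1) x 2)) y (EuclideanSpace.single 1 1) (EuclideanSpace.single 1 1) = 0)
    {C₅ : ℝ} (hC₅ : ∀ x, ‖iteratedFDeriv ℝ 5 (fun x => σ * v (-1) x 2) x‖ ≤ C₅)
    (e : OpenPartialHomeomorph (ℝ × ℝ) (ℝ × ℝ)) {a₁ a₂ r : ℝ} (ha : a₁ ≤ a₂) (hr : 0 < r) (hsrc : Icc a₁ a₂ ×ˢ Icc (-r) r ⊆ e.source)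
    {P : ℝ → ℝ × ℝ → EuclideanSpace ℝ (Fin 3)} (hP : ∀ z₀ q, P z₀ q = WithLp.toLp 2 ![q.1, q.2, z₀])
    {γ ν : ℝ → EuclideanSpace ℝ (Fin 3)} (hγν : ∀ s ∈ Icc a₁ a₂, ∀ n z : ℝ, P z (e (s, n)) = γ s + n • ν s + z • EuclideanSpace.single 2 1)
    (hν : ∀ s ∈ Icc a₁ a₂, ‖ν s‖ ≤ 1) (hγhot : ∀ s ∈ Icc a₁ a₂, γ s 2 = 0 ∧ v (-1) (γ s) 2 = v (-1) 0 2)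
    (hlat0 : ∀ a ∈ Icc a₁ a₂, ∀ n : ℝ, (n = r ∨ n = -r) → σ * v (-1) (P 0 (e (a, n))) 2 < σ * v (-1) 0 2)
    (hsole : ∀ a ∈ Icc a₁ a₂, ∀ n : ℝ, |n| ≤ r → n ≠ 0 → σ * v (-1) (P 0 (e (a, n))) 2 < σ * v (-1) 0 2)
    {Q : ℝ → ℝ → ℝ → ℝ} (hQ : ∀ s ∈ Icc a₁ a₂, ∀ n z : ℝ,
      Q s n z = -(1 / 24) * iteratedFDeriv ℝ 4 (fun x => σ * v (-1) x 2) (γ s) (fun _ => n • ν s + z • EuclideanSpace.single 2 1))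
    {m : ℝ → ℝ}
    (hpt : ∀ s ∈ Icc a₁ a₂, (∃ lam η₀ K : ℝ, 0 < lam ∧ (∀ n z : ℝ, lam * (n ^ 4 + z ^ 4) ≤ Q s n z) ∧ (∀ η : ℝ, m s ≤ Q s η 1) ∧
        Q s η₀ 1 = m s ∧ |η₀| ≤ K) ∨ (m s = 0 ∧ ∃ η₀ : ℝ, Q s η₀ 1 = 0))
    (h₁ : 0 < m a₁) (h₂ : 0 < m a₂) {s : ℝ} (hs : s ∈ Icc a₁ a₂) : 0 < m s := by
  have h1 : (-1 : ℝ) < 0 := by norm_num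
  have hslice_an : AnalyticOnNhd ℝ (v (-1)) univ := analyticOnNhd_slice hcont (bdd_of_hasTypeITimeDecay hdec) hmild h1
  have hslice : ContDiff ℝ ∞ (v (-1)) := contDiffOn_univ.1 hslice_an.contDiffOn_of_completeSpace
  set f : EuclideanSpace ℝ (Fin 3) → ℝ := fun x => σ * v (-1) x 2 with hfdef
  have hf : ContDiff ℝ ∞ f := contDiff_const.mul ((EuclideanSpace.proj (𝕜 := ℝ) (2 : Fin 3)).contDiff.comp hslice)
  have hC0 : 0 ≤ C₅ := (norm_nonneg _).trans (hC₅ 0)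
  have he2 : ‖(EuclideanSpace.single 2 (1 : ℝ) : EuclideanSpace ℝ (Fin 3))‖ ≤ 1 := by simp
  -- the global bound `σ v₂(−1,·) ≤ σN` from the hot-spot normalisation
  have hσabs : |σ| = 1 := by rcases hσ with h | h <;> simp [h]
  have hglob : ∀ x, σ * v (-1) x 2 ≤ σ * v (-1) 0 2 := fun x => by
    have h := hhot (-1) h1 x
    rw [show Real.sqrt (-(-1 : ℝ)) = 1 by norm_num, one_mul] at h
    calc σ * v (-1) x 2 ≤ |σ * v (-1) x 2| := le_abs_self _
      _ = |v (-1) x 2| := by rw [abs_mul, hσabs, one_mul]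
      _ ≤ |v (-1) 0 2| := h
      _ = σ * v (-1) 0 2 := hσN.symm
  -- the expansion along the arc (flat jets ⇒ (F-H′))
  have hexp : ∀ s ∈ Icc a₁ a₂, ∀ n z : ℝ, |σ * v (-1) (P z (e (s, n))) 2 - (σ * v (-1) 0 2 - Q s n z)| ≤ C₅ / 24 * (|n| + |z|) ^ 5 := by
    intro s hs n z
    obtain ⟨hy0, hy⟩ := hγhot s hs
    have hg1 : fderiv ℝ f (γ s) = 0 := by
      have h0 := hcrit (γ s) ⟨hy0, hy⟩
      have hd : DifferentiableAt ℝ (fun x => v (-1) x 2) (γ s) :=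
        ((EuclideanSpace.proj (𝕜 := ℝ) (2 : Fin 3)).differentiableAt).comp _ ((hslice.differentiable (by simp)) _)
      rw [hfdef, fderiv_const_mul hd, h0, smul_zero]
    have hg2 : ∀ w, fderiv ℝ (fderiv ℝ f) (γ s) w w = 0 := fun w =>
      hessian_eq_zero_of_flatHotPoint hdec hcont hmild hdiv hTH hne hhot hproper hσN hy0 hy (hflatlaw _ hy0 hy) w w
    have hg3 : ∀ w, fderiv ℝ (fderiv ℝ (fun x => fderiv ℝ f x w)) (γ s) w w = 0 := fun w =>
      cubic_eq_zero_of_flatHotPoint hdec hcont hmild hdiv hTH hne hhot hproper hσN hy0 hy (hflatlaw _ hy0 hy) w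
    have h := quarticRidgeExpansion_of_flatJets hf hC₅ hg1 hg2 hg3 (hν s hs) he2 (Q := Q s) (hQ s hs) n z
    rw [hγν s hs n z]
    have ef : f (γ s) = σ * v (-1) 0 2 := by rw [hfdef]; simp only; rw [hy]
    rw [← ef]
    exact h
  have hmid0 : ∀ a ∈ Icc a₁ a₂, σ * v (-1) (P 0 (e (a, 0))) 2 = σ * v (-1) 0 2 := by
    intro a ha'
    rw [hγν a ha' 0 0, zero_smul, zero_smul, add_zero, add_zero, (hγhot a ha').2]
  have hhom : ∀ s ∈ Icc a₁ a₂, ∀ η t : ℝ, Q s (η * t) t = t ^ 4 * Q s η 1 := fun s hs η t =>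
    quartic_homogeneous f (γ s) (ν s) (EuclideanSpace.single 2 1) (hQ s hs) η t
  exact pos_of_definite_ends hpk hcont hσ e ha hr hsrc hP hlat0 hmid0 hsole hglob (by positivity) hhom hexp hpt h₁ h₂ hs

end Summit.NavierStokesRegularity.NavierStokesRegularity.Theorems.PoloidalWindowDoorLrcModEntireTwistingTHFlatSeparation

end
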